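import Mathlib.MeasureTheory.Measure.Lebesgue.EqHaar
import Literature.Algebra.EuclideanLattices.SuccessiveMinima
import HarnessLib

/-!
# Lattice points in a ball: the packing bound `#(L ∩ (c + B(d))) ≤ (1 + 2d/λ₁(L))ⁿ` (Dadush–Peikert–Vempala, Lemma 4.3)

Topic `Literature/Algebra/EuclideanLattices`; namespace `Literature.Algebra.EuclideanLattices`. PROVED THEOREMS only
(0 definitions, 0 named facts, 0 sorry).

Source: D. Dadush, C. Peikert, S. Vempala, *Enumerative Lattice Algorithms in any Norm via M-Ellipsoid Coverings*
(FOCS 2011; arXiv:1011.5666) [DadushPeikertVempala2010], **Lemma 4.3** (held arXiv render `paper:arxiv-1011.5666`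
chunk p0011 L105 – p0012 L8): «Let `K ⊆ ℝⁿ` be a convex body satisfying `vol(K ∩ −K) ≥ γ^{−n} vol(K)`, `γ ≥ 1`, and let `L`
be an `n`-dimensional lattice. Then for `d > 0` we have that `G(dK, L) ≤ (γ(1 + 2d/λ₁(K, L)))ⁿ`», where `G(dK, L)` is the
maximal number of lattice points in a translate `c + dK` (§2), with the printed proof (p0011 L126 – p0012 L8): for
`s = λ₁/2` the bodies `x + int(s(K ∩ −K))`, `x ∈ L`, are pairwise disjoint; for `x ∈ c + dK` they lie in `c + (d+s)K`;
hence `|(c + dK) ∩ L| ≤ vol((d+s)K)/vol(s(K ∩ −K)) = (γ(1 + 2d/λ₁(K,L)))ⁿ`. Here: `K` = the unit ball of a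
finite-dimensional real normed space (centrally symmetric, `γ = 1`); the same packing argument is §1's «copies of `¼K`
centered at each point in `(K+x) ∩ L` are pairwise disjoint … and contained in `⁵⁄₄K + x`» (chunk p0005 L69–80).

Lean form (`E` a finite-dimensional real normed space, `n = finrank ℝ E`, any add-Haar measure in the proof):
* `card_le_pow_of_forall_norm_sub_ge` — the argument for an arbitrary finite `λ`-SEPARATED set in a ball of radius `d`:
  `#S ≤ (1 + 2d/λ)ⁿ`;
* `card_le_pow_of_forall_mem_lattice` — Lemma 4.3 for the ball: `S ⊆ L` finite, `S ⊆ c + B(d)` ⇒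
  `#S ≤ (1 + 2d/λ₁(L))ⁿ` (`λ₁ = minNorm L > 0`);
* `card_le_pow_of_norm_le_mul_minNorm` — radius `c·λ₁`: `#{v ∈ L : ‖v‖ ≤ c λ₁(L)} ≤ (1 + 2c)ⁿ` for every finite
  subfamily, and its contrapositive `exists_mul_minNorm_lt_norm_of_pow_lt_card` (any `N > (1+2c)ⁿ` distinct lattice
  vectors contain one longer than `c λ₁`).

WHY IT IS HERE (LADDER-PQC LIT-2, the CERTIFIED side of two printed HEURISTICS; nothing below is asserted as a theorem):
[MATZOV2022] Assumption 2.2 (Gaussian Heuristic; held render `paper:url-204809cd6cb9` p0009 L18–32) «for every `c > 1`,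
`#{v ∈ Λ | ‖v‖ ≤ c · λ₁(Λ)} ≈ c^d`. … The latter conclusion implies that the vectors returned by a sieve in a lattice of
dimension `β`, which are the `N_sieve(β)` shortest lattice vectors, have length at most `N_sieve(β)^{1/β}` times the length of
the shortest lattice vector», and [AvanziEtAl2021KyberSpec] §5.1.3 p. 26 L55–59 «the sieving algorithms provides `2^{0.2075b}`
vectors … This makes the conservative assumption that all the vectors provided by the Sieve algorithm are as short as the
shortest one» (X1.GH [H4] / X1.SieveSaturation [H10] of the `pqc` model list). The theorems give the UNCONDITIONAL CEILING
`(1 + 2c)ⁿ` on the heuristic count `cⁿ`, for every lattice and every finite list of its vectors — never a floor, never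
an approximation.

## References
* [DadushPeikertVempala2010] D. Dadush, C. Peikert, S. Vempala, FOCS 2011 / arXiv:1011.5666, §1 (packing argument) and
  Lemma 4.3 with its proof.
* [MATZOV2022] IDF MATZOV, *Report on the Security of LWE: Improved Dual Lattice Attack* (2022), Assumption 2.2 p. 9.
* [AvanziEtAl2021KyberSpec] CRYSTALS-Kyber v3.02, §5.1.3 p. 26.
-/

noncomputable section

open MeasureTheory Metric Module
open scoped ENNReal

namespace Literature.Algebra.EuclideanLattices

section Packing

variable {E : Type*} [NormedAddCommGroup E] [NormedSpace ℝ E] [FiniteDimensional ℝ E]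

/-- **The packing argument** (proof of [DadushPeikertVempala2010] Lemma 4.3, `K` = the unit ball, `γ = 1`): if the
points of a finite set `S` are pairwise at distance `≥ λ > 0` and all lie within distance `d` of a centre `c`, then
`#S ≤ (1 + 2d/λ)ⁿ`, `n = dim E` — the balls `B(x, λ/2)`, `x ∈ S`, are pairwise disjoint and contained in
`B(c, d + λ/2)`, so `#S · (λ/2)ⁿ · vol B(0,1) ≤ (d + λ/2)ⁿ · vol B(0,1)`.
[cite: DadushPeikertVempala2010, Lemma 4.3 (proof, chunk p0011 L126 – p0012 L8)] -/
theorem card_le_pow_of_forall_norm_sub_ge (S : Finset E) {lam d : ℝ} (hlam : 0 < lam) (hd : 0 ≤ d) (c : E)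
    (hsep : ∀ x ∈ S, ∀ y ∈ S, x ≠ y → lam ≤ ‖x - y‖) (hS : ∀ x ∈ S, ‖x - c‖ ≤ d) :
    (S.card : ℝ) ≤ (1 + 2 * d / lam) ^ finrank ℝ E := by
  classical
  borelize E
  set n : ℕ := finrank ℝ E with hn
  set μ : Measure E := Measure.addHaar with hμ
  have hr : 0 < lam / 2 := by positivity
  -- the small balls are pairwise disjoint
  have hdisj : (S : Set E).PairwiseDisjoint (fun x => ball x (lam / 2)) := by
    intro x hx y hy hxy
    refine ball_disjoint_ball ?_
    rw [dist_eq_norm]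
    linarith [hsep x hx y hy hxy]
  -- and contained in the big ball
  have hsub : (⋃ x ∈ S, ball x (lam / 2)) ⊆ ball c (d + lam / 2) := by
    refine Set.iUnion₂_subset fun x hx => ball_subset_ball' ?_
    rw [dist_eq_norm]
    linarith [hS x hx]
  have hB0 : μ (ball (0 : E) 1) ≠ 0 := (isOpen_ball.measure_pos μ ⟨0, mem_ball_self one_pos⟩).ne'
  have hBtop : μ (ball (0 : E) 1) ≠ ⊤ := measure_ball_lt_top.ne
  have hmeas : μ (⋃ x ∈ S, ball x (lam / 2)) = ∑ x ∈ S, μ (ball x (lam / 2)) :=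
    measure_biUnion_finset hdisj fun x _ => measurableSet_ball
  have hsum : ∑ x ∈ S, μ (ball x (lam / 2)) =
      (S.card : ℝ≥0∞) * (ENNReal.ofReal ((lam / 2) ^ n) * μ (ball 0 1)) := by
    rw [Finset.sum_congr rfl fun x _ => Measure.addHaar_ball_of_pos μ x hr, Finset.sum_const, nsmul_eq_mul]
  have hbig : μ (ball c (d + lam / 2)) = ENNReal.ofReal ((d + lam / 2) ^ n) * μ (ball 0 1) :=
    Measure.addHaar_ball_of_pos μ c (by linarith)
  have hle : (S.card : ℝ≥0∞) * ENNReal.ofReal ((lam / 2) ^ n) * μ (ball 0 1) ≤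
      ENNReal.ofReal ((d + lam / 2) ^ n) * μ (ball 0 1) := by
    rw [mul_assoc, ← hsum, ← hmeas, ← hbig]
    exact measure_mono hsub
  have hle' : (S.card : ℝ≥0∞) * ENNReal.ofReal ((lam / 2) ^ n) ≤ ENNReal.ofReal ((d + lam / 2) ^ n) :=
    (ENNReal.mul_le_mul_iff_left hB0 hBtop).1 hle
  have hreal : (S.card : ℝ) * (lam / 2) ^ n ≤ (d + lam / 2) ^ n := by
    rw [← ENNReal.ofReal_natCast, ← ENNReal.ofReal_mul (Nat.cast_nonneg _)] at hle'
    exact (ENNReal.ofReal_le_ofReal_iff (by positivity)).1 hle'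
  have hpow : 0 < (lam / 2) ^ n := pow_pos hr n
  have hrew : (1 + 2 * d / lam) = (d + lam / 2) / (lam / 2) := by
    field_simp
    ring
  rw [hrew, div_pow, le_div_iff₀ hpow]
  exact hreal

omit [NormedSpace ℝ E] [FiniteDimensional ℝ E] in
/-- Distinct vectors of a `ℤ`-submodule `L` are at distance `≥ λ₁(L) = minNorm L` (their difference is a non-zero vector
of `L`). [cite: DadushPeikertVempala2010, Lemma 4.3 (proof: «a clear contradiction since `y − x ≠ 0`», chunk p0011 L140–146)] -/
theorem minNorm_le_norm_sub {L : Submodule ℤ E} {x y : E} (hx : x ∈ L) (hy : y ∈ L) (hxy : x ≠ y) :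
    minNorm L ≤ ‖x - y‖ :=
  csInf_le ⟨0, by rintro _ ⟨z, -, rfl⟩; exact norm_nonneg z⟩ ⟨x - y, ⟨L.sub_mem hx hy, sub_ne_zero.2 hxy⟩, rfl⟩

/-- **[DadushPeikertVempala2010] Lemma 4.3 for the ball**: every finite set of vectors of a lattice `L` (a `ℤ`-submodule
with `λ₁(L) > 0`) inside a ball `c + B(d)` has at most `(1 + 2d/λ₁(L))ⁿ` elements, `n = dim E` — «`G(dK, L) ≤
(γ(1 + 2d/λ₁(K,L)))ⁿ`» with `K` the unit ball, `γ = 1`. [cite: DadushPeikertVempala2010, Lemma 4.3 (chunk p0011 L105–118)] -/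
theorem card_le_pow_of_forall_mem_lattice (L : Submodule ℤ E) (hL : 0 < minNorm L) (S : Finset E)
    (hSL : ∀ x ∈ S, x ∈ L) (c : E) {d : ℝ} (hd : 0 ≤ d) (hS : ∀ x ∈ S, ‖x - c‖ ≤ d) :
    (S.card : ℝ) ≤ (1 + 2 * d / minNorm L) ^ finrank ℝ E :=
  card_le_pow_of_forall_norm_sub_ge S hL hd c
    (fun x hx y hy hxy => minNorm_le_norm_sub (hSL x hx) (hSL y hy) hxy) hS

/-- **The number of lattice vectors of norm `≤ c·λ₁(L)` is at most `(1 + 2c)ⁿ`** (any finite family of them; `c ≥ 0`,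
`λ₁(L) > 0`) — the unconditional CEILING beside the Gaussian-heuristic count «`#{v ∈ Λ | ‖v‖ ≤ c · λ₁(Λ)} ≈ c^d`» of
[MATZOV2022] Assumption 2.2 (there an ASSUMPTION about «random» lattices; nothing about it is asserted here).
[cite: DadushPeikertVempala2010, Lemma 4.3 (chunk p0011 L105–118); MATZOV2022, Assumption 2.2 p. 9 L27–28] -/
theorem card_le_pow_of_norm_le_mul_minNorm (L : Submodule ℤ E) (hL : 0 < minNorm L) (S : Finset E)
    (hSL : ∀ x ∈ S, x ∈ L) {c : ℝ} (hc : 0 ≤ c) (hS : ∀ x ∈ S, ‖x‖ ≤ c * minNorm L) :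
    (S.card : ℝ) ≤ (1 + 2 * c) ^ finrank ℝ E := by
  have h := card_le_pow_of_forall_mem_lattice L hL S hSL 0 (by positivity : (0 : ℝ) ≤ c * minNorm L)
    (fun x hx => by rw [sub_zero]; exact hS x hx)
  have hrew : 1 + 2 * (c * minNorm L) / minNorm L = 1 + 2 * c := by
    field_simp
  rwa [hrew] at h

/-- **Contrapositive (a FLOOR on the length reached by any `N` distinct lattice vectors)**: if a finite family `S ⊆ L` has
more than `(1 + 2c)ⁿ` elements, one of them is longer than `c·λ₁(L)` — so the `N_sieve(β)` shortest vectors of a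
`β`-dimensional lattice reach length `> c·λ₁` as soon as `N_sieve(β) > (1 + 2c)^β`; the printed «length at most
`N_sieve(β)^{1/β}` times the length of the shortest lattice vector» is the Gaussian-heuristic VALUE, this is the
unconditional constraint. [cite: MATZOV2022, Assumption 2.2 p. 9 L27–32; DadushPeikertVempala2010, Lemma 4.3] -/
theorem exists_mul_minNorm_lt_norm_of_pow_lt_card (L : Submodule ℤ E) (hL : 0 < minNorm L) (S : Finset E)
    (hSL : ∀ x ∈ S, x ∈ L) {c : ℝ} (hc : 0 ≤ c) (hN : (1 + 2 * c) ^ finrank ℝ E < (S.card : ℝ)) :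
    ∃ x ∈ S, c * minNorm L < ‖x‖ := by
  by_contra h
  push Not at h
  exact (not_le.2 hN) (card_le_pow_of_norm_le_mul_minNorm L hL S hSL hc h)

/-- **The sieve-saturation radius `√(4/3)·λ₁`** ([AvanziEtAl2021KyberSpec] §5.1.3: the `2^{0.2075 b}` sieve vectors, all
«as short as the shortest one» up to the factor `√(4/3) = (2^{0.2075·b})^{1/b}` of [MATZOV2022] Ass. 2.2 / 7.1): any finite
family of lattice vectors of norm `≤ √(4/3)·λ₁(L)` has at most `(1 + 2√(4/3))ⁿ ≤ 3.31ⁿ` elements — the unconditional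
ceiling beside the heuristic list size `(4/3)^{n/2} ≈ 1.155ⁿ`. [cite: AvanziEtAl2021KyberSpec, §5.1.3 p. 26 L55–59; MATZOV2022, Assumption 2.2 p. 9 L27–32] -/
theorem card_le_pow_of_norm_le_sqrt_four_thirds_mul_minNorm (L : Submodule ℤ E) (hL : 0 < minNorm L) (S : Finset E)
    (hSL : ∀ x ∈ S, x ∈ L) (hS : ∀ x ∈ S, ‖x‖ ≤ Real.sqrt (4 / 3) * minNorm L) :
    (S.card : ℝ) ≤ (331 / 100 : ℝ) ^ finrank ℝ E := by
  have h := card_le_pow_of_norm_le_mul_minNorm L hL S hSL (Real.sqrt_nonneg _) hS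
  refine h.trans (pow_le_pow_left₀ (by positivity) ?_ _)
  have hs : Real.sqrt (4 / 3) ≤ 1155 / 1000 := by
    rw [Real.sqrt_le_left (by norm_num)]
    norm_num
  linarith

end Packing

end Literature.Algebra.EuclideanLattices
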